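import Literature.AlgebraicGeometry.Resolution.DerivativeIdealsChart
import Literature.AlgebraicGeometry.Resolution.DerivativeIdealsLocalization
import Literature.AlgebraicGeometry.Resolution.AffineBlowup
import HarnessLib

/-!
# The affine blowup algebra `R[I/a] ⊆ R[1/a]`, its derivations, and the chart ring `(R[It])_{(at)}`

Topic: `Literature/AlgebraicGeometry/Resolution`. The **affine blowup algebra** of an ideal `I`
at an element `a`, in its IMAGE MODEL inside the localization `R[1/a]`: the `R`-subalgebra of
`R[1/a]` generated by the fractions `x/a`, `x ∈ I` (this is how Görtz–Wedhorn, *Algebraic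
Geometry I*, (13.19), p. 415, introduce the charts `A[I/f] ⊆ A_f` of a blow-up). The Stacks
Project (Tag 052Q) DEFINES `R[I/a]`, for `a ∈ I`, as the homogeneous localization
`(Bl_I(R))_{(a^{(1)})}` of the Rees algebra — in the tree this is the chart ring
`HomogeneousLocalization.Away (reesGrading I) (reesT a ha)` of `AffineBlowup.lean` (with the chart
map `reesChart` to `R[1/a]`) — and shows in Lemma 07Z3 that (1) the image of `a` in it is a
nonzerodivisor, (2) `I R[I/a] = a R[I/a]`, (3) `(R[I/a])_a = R_a`; by (1)+(3) Stacks' algebra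
embeds into `R[1/a]` with image the subalgebra considered here. This identification is PROVED
below (`reesChart_injective`, `range_reesChart`, `reesChartEquiv`), so the two models are
interchangeable. The definition `blowupAlgebra I a` itself is stated WITHOUT the hypothesis
`a ∈ I` (then it is merely some subalgebra of `R[1/a]`, e.g. `⊥` for `I = (a)`); `a ∈ I` enters
where needed (`map_blowupAlgebra_eq_span`, the chart identification).

PROVED, for the subalgebra model (the three inputs of the abstract charts of
`DerivativeIdealsChart.lean`, and the bridge):

* `algebraMap_mem_nonZeroDivisors_blowupAlgebra` — `a` is a non-zero-divisor of `R[I/a]` (it is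
  a unit of `R[1/a] ⊇ R[I/a]`; Stacks 07Z3 (1) for the image model);
* `map_blowupAlgebra_eq_span` — `I · R[I/a] = (a)` for `a ∈ I` (Stacks 07Z3 (2));
* `exists_derivation_blowupAlgebra` — for every `k`-derivation `δ` of `R`, the derivation
  `a · δ̃` of `R[1/a]` (`δ̃` the extension of `δ`, `DerivativeIdealsLocalization.lean`) preserves
  `R[I/a]`: `a · δ̃(x/a) = δ(x) − (x/a) · δ(a)`; so it restricts to a `k`-derivation `D` of `R[I/a]`
  with `D(r) = a δ(r)` for `r ∈ R` [folklore; the new input];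
* `blowupAlgebra.colon_map_derivIdeal_le` — hence **BGMW Lemma 3.5.3 (`r = 1`) on the charts of
  a blow-up**: for `J ⊆ I^μ`, `μ ≥ 1`, `(𝒟_k(J) R[I/a] : a^{μ-1}) ⊆ 𝒟_k((J R[I/a] : a^μ))`, in
  every characteristic;
* `reesChart_injective`, `reesChart_mk`, `range_reesChart`, `reesChartEquiv`,
  `reesChartEquiv_reesChartBase` — **`(R[It])_{(at)} ≅ R[I/a]`** compatibly with the maps from `R`
  (Stacks 07Z3 (1)+(3); GW (13.19)): the chart ring of `Proj R[It]` used throughout the tree IS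
  the affine blowup algebra, so chart-ring results (`BlowupChartRegular.lean`,
  `ExceptionalDivisorRegular.lean`, `AffineBlowupCartier.lean`) and subalgebra results transport
  along `reesChartEquiv`.

## Related files

* `AffineBlowup.lean` — `affineBlowup I = Proj R[It]`, the chart rings
  `HomogeneousLocalization.Away (reesGrading I) (reesT a ha)` (Stacks' `R[I/a]`), `reesChart`,
  `reesChartBase_mem_nonZeroDivisors` and `span_image_reesChartBase_eq` (Stacks 07Z3 (1), (2) for
  that model), `isLocalization_reesChart` (07Z3 (3)); local notation `B` for the chart ring in
  `BlowupChartQuasiRegular.lean`, `BlowupChartRegular.lean`.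
* `QuadraticTransforms.lean` — `blowupRing R x`, a third, field-embedded model `R[𝔪/x] ⊆ K` for a
  local domain inside its fraction field (Abhyankar's quadratic transforms); for `x ∈ 𝔪` it is the
  image of `R[𝔪/x]` under `R[1/x] → K`.

## Sources

* The Stacks Project, Tag 052Q (definition of the affine blowup algebra), Tag 07Z3 (1)–(3) (its
  basic properties), Tag 0804 (blowing up = `Proj` of the Rees algebra, charts). [StacksProject]
* U. Görtz, T. Wedhorn, *Algebraic Geometry I*, 2nd ed. (2020), (13.19), p. 415 (`A[I/f] ⊆ A_f`
  generated by the `x/f`). [GortzWedhorn2020]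
* E. Bierstone, D. Grigoriev, P. Milman, J. Włodarczyk, arXiv:1206.3090, Lemma 3.5.3, §3.2
  (held-text numbering; arXiv v1 PDF: Lemma 2.5.3, §2.2). [BierstoneGrigorievMilmanWlodarczyk2011]
-/

noncomputable section

open Polynomial HomogeneousLocalization IsLocalization

namespace Literature.AlgebraicGeometry.Resolution

universe u v

section Def

variable {R : Type u} [CommRing R] (I : Ideal R) (a : R)

/-- The generators `x/a`, `x ∈ I`, of the affine blowup algebra inside `R[1/a]` (GW (13.19):
`A[I/f]` "generated by all elements of the form `x/f`"; Stacks 052Q: every element of `R[I/a]` is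
"represented by an expression of the form `x/aⁿ` with `x ∈ Iⁿ`"). [cite: GortzWedhorn2020, (13.19) p. 415] -/
def blowupAlgebraGens : Set (Localization.Away a) :=
  {y | ∃ x ∈ I, y = algebraMap R (Localization.Away a) x * Away.invSelf a}

/-- **The affine blowup algebra `R[I/a] ⊆ R[1/a]`, image model**: the `R`-subalgebra of `R[1/a]`
generated by the `x/a`, `x ∈ I` (Görtz–Wedhorn (13.19), p. 415; for `a ∈ I` it is the image of
Stacks' `R[I/a] = (Bl_I(R))_{(a^{(1)})}`, Tag 052Q, under the injection of Tag 07Z3 (3) —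
`range_reesChart` below). No hypothesis `a ∈ I` is imposed on the definition.
[cite: GortzWedhorn2020, (13.19) p. 415] -/
def blowupAlgebra : Subalgebra R (Localization.Away a) :=
  Algebra.adjoin R (blowupAlgebraGens I a)

/-- `x/a ∈ R[I/a]` for `x ∈ I`. [cite: GortzWedhorn2020, (13.19) p. 415] -/
theorem div_mem_blowupAlgebra {x : R} (hx : x ∈ I) :
    algebraMap R (Localization.Away a) x * Away.invSelf a ∈ blowupAlgebra I a :=
  Algebra.subset_adjoin ⟨x, hx, rfl⟩

/-- `(x/a) · a = x` in `R[1/a]`. [folklore] -/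
theorem div_mul_algebraMap (x : R) :
    algebraMap R (Localization.Away a) x * Away.invSelf a * algebraMap R (Localization.Away a) a =
      algebraMap R (Localization.Away a) x := by
  rw [mul_assoc, mul_comm (Away.invSelf a), Away.mul_invSelf, mul_one]

end Def

section Properties

variable {R : Type u} [CommRing R] {I : Ideal R} {a : R}

/-- **`a` is a non-zero-divisor of `R[I/a]`** (Stacks, Lemma 07Z3 (1), here for the image
model, where it is immediate: `a` is a unit of `R[1/a] ⊇ R[I/a]`). [cite: StacksProject, Tag 07Z3 (1)] -/
theorem algebraMap_mem_nonZeroDivisors_blowupAlgebra :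
    algebraMap R (blowupAlgebra I a) a ∈ nonZeroDivisors (blowupAlgebra I a) := by
  refine mem_nonZeroDivisors_of_injective (f := (blowupAlgebra I a).val) Subtype.val_injective ?_
  exact (IsLocalization.Away.algebraMap_isUnit (S := Localization.Away a) a).mem_nonZeroDivisors

/-- **`I · R[I/a] = (a)`** (Stacks, Lemma 07Z3 (2): `I R[I/a] = a R[I/a]`): `x = a · (x/a)` for
`x ∈ I`, and `a ∈ I`. [cite: StacksProject, Tag 07Z3 (2)] -/
theorem map_blowupAlgebra_eq_span (ha : a ∈ I) :
    I.map (algebraMap R (blowupAlgebra I a)) = Ideal.span {algebraMap R (blowupAlgebra I a) a} := by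
  apply le_antisymm
  · rw [Ideal.map_le_iff_le_comap]
    intro x hx
    rw [Ideal.mem_comap, Ideal.mem_span_singleton']
    refine ⟨⟨_, div_mem_blowupAlgebra I a hx⟩, Subtype.ext ?_⟩
    exact div_mul_algebraMap a x
  · rw [Ideal.span_le, Set.singleton_subset_iff]
    exact Ideal.mem_map_of_mem _ ha

section Derivations

variable (k : Type v) [CommRing k] [Algebra k R]

/-- **`a · δ` extends to the affine blowup algebra**: for a `k`-derivation `δ` of `R`, the
derivation `a · δ̃` of `R[1/a]` (`δ̃` the unique extension of `δ`) maps `R[I/a]` into itself,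
since `a · δ̃(x/a) = δ(x) − (x/a) δ(a)`; its restriction `D` satisfies `D(r) = a · δ(r)`.
[folklore] -/
theorem exists_derivation_blowupAlgebra (δ : Derivation k R R) :
    ∃ D : Derivation k (blowupAlgebra I a) (blowupAlgebra I a), ∀ r : R,
      D (algebraMap R (blowupAlgebra I a) r) =
        algebraMap R (blowupAlgebra I a) a * algebraMap R (blowupAlgebra I a) (δ r) := by
  set L := Localization.Away a
  obtain ⟨δ', hδ'⟩ := exists_derivation_extend_of_isLocalization k L (Submonoid.powers a) δ
  -- `D' = a · δ̃` preserves `R[I/a]`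
  let D' : Derivation k L L := algebraMap R L a • δ'
  have hD' : ∀ y : L, D' y = algebraMap R L a * δ' y := fun y => rfl
  have hgen : ∀ x ∈ I, D' (algebraMap R L x * Away.invSelf a) =
      algebraMap R L (δ x) - algebraMap R L x * Away.invSelf a * algebraMap R L (δ a) := by
    intro x _
    have h := congrArg δ' (div_mul_algebraMap a x)
    rw [Derivation.leibniz, hδ', hδ', smul_eq_mul, smul_eq_mul] at h
    rw [hD', eq_sub_iff_add_eq, ← h]
    ring
  have hmem : ∀ y ∈ blowupAlgebra I a, D' y ∈ blowupAlgebra I a := by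
    intro y hy
    induction hy using Algebra.adjoin_induction with
    | mem y hy =>
      obtain ⟨x, hx, rfl⟩ := hy
      rw [hgen x hx]
      exact Subalgebra.sub_mem _ (Subalgebra.algebraMap_mem _ _)
        (Subalgebra.mul_mem _ (div_mem_blowupAlgebra I a hx) (Subalgebra.algebraMap_mem _ _))
    | algebraMap r =>
      rw [hD', hδ']
      exact Subalgebra.mul_mem _ (Subalgebra.algebraMap_mem _ _) (Subalgebra.algebraMap_mem _ _)
    | add y z _ _ hy hz =>
      rw [map_add]
      exact Subalgebra.add_mem _ hy hz
    | mul y z hy' hz' hy hz =>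
      rw [Derivation.leibniz, smul_eq_mul, smul_eq_mul]
      exact Subalgebra.add_mem _ (Subalgebra.mul_mem _ hy' hz) (Subalgebra.mul_mem _ hz' hy)
  -- the restriction of `D'` to `R[I/a]`
  let Dlin : blowupAlgebra I a →ₗ[k] blowupAlgebra I a :=
    { toFun := fun y => ⟨D' y, hmem y y.2⟩
      map_add' := fun y z => Subtype.ext (by simp)
      map_smul' := fun c y => Subtype.ext (by simp) }
  refine ⟨⟨Dlin, Subtype.ext ?_, fun y z => Subtype.ext ?_⟩, fun r => Subtype.ext ?_⟩
  · change D' 1 = 0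
    exact D'.map_one_eq_zero
  · change D' (y * z) = (y • (⟨D' z, hmem z z.2⟩ : blowupAlgebra I a) +
      z • (⟨D' y, hmem y y.2⟩ : blowupAlgebra I a) : blowupAlgebra I a).val
    rw [Derivation.leibniz]
    rfl
  · change D' (algebraMap R L r) = algebraMap R L a * algebraMap R L (δ r)
    rw [hD', hδ']

/-- **BGMW Lemma 3.5.3 (`r = 1`) on the chart `Spec R[I/a]` of the blow-up of `Spec R` along
`I`** ("`σᶜ(𝒟(𝓘, μ)) ⊆ 𝒟(σᶜ(𝓘, μ))`", Giraud, Villamayor): if `J ⊆ I^μ` with `μ ≥ 1` (e.g.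
`V(I) ⊆ supp(J, μ)`, Lemma 3.2.1), then in `R[I/a]` the controlled transform
`(𝒟_k(J) · R[I/a] : a^{μ-1})` of `(𝒟(J), μ - 1)` is contained in the derivative ideal
`𝒟_k((J · R[I/a] : a^μ))` of the controlled transform of `(J, μ)` — in every characteristic
(`DerivativeIdealsChart.lean`). [cite: BierstoneGrigorievMilmanWlodarczyk2011, Lemma 3.5.3] -/
theorem blowupAlgebra.colon_map_derivIdeal_le (ha : a ∈ I) {J : Ideal R} {μ : ℕ} (hμ : 1 ≤ μ)
    (hJ : J ≤ I ^ μ) :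
    ((derivIdeal k J).map (algebraMap R (blowupAlgebra I a))).colon
        {algebraMap R (blowupAlgebra I a) a ^ (μ - 1)} ≤
      derivIdeal k ((J.map (algebraMap R (blowupAlgebra I a))).colon
        {algebraMap R (blowupAlgebra I a) a ^ μ}) :=
  colon_map_derivIdeal_le_derivIdeal_colon k algebraMap_mem_nonZeroDivisors_blowupAlgebra
    (map_blowupAlgebra_eq_span ha) (exists_derivation_blowupAlgebra k) hμ hJ

end Derivations

end Properties

/-! ## The chart ring `(R[It])_{(at)}` of `Proj R[It]` is `R[I/a]` (Stacks 07Z3 (1)+(3)) -/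

section ChartRing

variable {R : Type u} [CommRing R] {I : Ideal R} (a : R) (ha : a ∈ I)

/-- **`reesChart` is injective**: `R[1/a]` is the localization of the chart ring at the
non-zero-divisor `a/1`. [cite: StacksProject, Tag 0804] -/
theorem reesChart_injective : Function.Injective (reesChart a ha) := by
  letI := (reesChart a ha).toAlgebra
  haveI := isLocalization_reesChart a ha
  have h : Submonoid.powers (reesChartBase a ha a) ≤
      nonZeroDivisors (HomogeneousLocalization.Away (reesGrading I) (reesT a ha)) :=
    Submonoid.powers_le.mpr (reesChartBase_mem_nonZeroDivisors a ha)
  exact IsLocalization.injective (M := Submonoid.powers (reesChartBase a ha a))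
    (S := Localization.Away a) h

/-- `r/aⁿ ∈ R[I/a]` for `r ∈ Iⁿ` (Stacks 052Q: the elements of `R[I/a]` are "represented by an
expression of the form `x/aⁿ` with `x ∈ Iⁿ`"). [cite: StacksProject, Tag 052Q] -/
theorem algebraMap_mul_invSelf_pow_mem_blowupAlgebra :
    ∀ (n : ℕ) {r : R}, r ∈ I ^ n →
      algebraMap R (Localization.Away a) r * IsLocalization.Away.invSelf a ^ n ∈ blowupAlgebra I a
  | 0, r, _ => by
    rw [pow_zero, mul_one]
    exact Subalgebra.algebraMap_mem _ r
  | n + 1, r, hr => by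
    rw [pow_succ] at hr
    refine Submodule.mul_induction_on hr (fun s hs t ht => ?_) (fun x y hx hy => ?_)
    · rw [map_mul, pow_succ, mul_mul_mul_comm]
      exact Subalgebra.mul_mem _ (algebraMap_mul_invSelf_pow_mem_blowupAlgebra n hs)
        (div_mem_blowupAlgebra I a ht)
    · rw [map_add, add_mul]
      exact Subalgebra.add_mem _ hx hy

/-- **The chart map on fractions**: `reesChart (x/(at)ⁿ) = r/aⁿ` when `x = r tⁿ`.
[cite: StacksProject, Tag 0804] -/
theorem reesChart_mk {n : ℕ} {x : reesAlgebra I} (hx : x ∈ reesGrading I (n • 1)) {r : R}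
    (hr : (x : R[X]) = monomial n r) :
    reesChart a ha (HomogeneousLocalization.Away.mk (reesGrading I) (reesT_mem a ha) n x hx) =
      algebraMap R (Localization.Away a) r * IsLocalization.Away.invSelf a ^ n := by
  have h := reesChart_mk_mul_pow a ha n x hx
  rw [reesEval_of_eq_monomial a hr] at h
  have hinv : algebraMap R (Localization.Away a) a ^ n * IsLocalization.Away.invSelf a ^ n = 1 := by
    rw [← mul_pow, IsLocalization.Away.mul_invSelf, one_pow]
  calc reesChart a ha (HomogeneousLocalization.Away.mk (reesGrading I) (reesT_mem a ha) n x hx)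
      = reesChart a ha (HomogeneousLocalization.Away.mk (reesGrading I) (reesT_mem a ha) n x hx) *
          (algebraMap R (Localization.Away a) a ^ n * IsLocalization.Away.invSelf a ^ n) := by
        rw [hinv, mul_one]
    _ = algebraMap R (Localization.Away a) r * IsLocalization.Away.invSelf a ^ n := by
        rw [← mul_assoc, h]

/-- **The image of the chart map is the affine blowup algebra `R[I/a]`** (Stacks 07Z3 (3) with
(1): `R[I/a] ⊆ R[1/a]`, generated by the `x/a`). [cite: StacksProject, Tag 07Z3 (3)] -/
theorem range_reesChart :
    Set.range (reesChart a ha) = (blowupAlgebra I a : Set (Localization.Away a)) := by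
  apply le_antisymm
  · rintro _ ⟨y, rfl⟩
    obtain ⟨n, x, hx, rfl⟩ :=
      HomogeneousLocalization.Away.mk_surjective (reesGrading I) (reesT_mem a ha) y
    obtain ⟨r, hr⟩ := (mem_reesGrading_iff I).mp hx
    have hn : (n • 1 : ℕ) = n := by simp
    have hr' : (x : R[X]) = monomial n r := by rw [← hr, hn]
    have hrI : r ∈ I ^ n := by
      have := x.2
      rw [hr', reesAlgebra.monomial_mem] at this
      exact this
    change reesChart a ha _ ∈ blowupAlgebra I a
    rw [reesChart_mk a ha hx hr']
    exact algebraMap_mul_invSelf_pow_mem_blowupAlgebra a n hrI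
  · -- `R[I/a]` is generated by the `x/a = reesChart ((xt)/(at))`, and `R` maps into the range
    let T : Subalgebra R (Localization.Away a) :=
      { carrier := Set.range (reesChart a ha)
        mul_mem' := by
          rintro _ _ ⟨y₁, rfl⟩ ⟨y₂, rfl⟩
          exact ⟨y₁ * y₂, map_mul _ _ _⟩
        one_mem' := ⟨1, map_one _⟩
        add_mem' := by
          rintro _ _ ⟨y₁, rfl⟩ ⟨y₂, rfl⟩
          exact ⟨y₁ + y₂, map_add _ _ _⟩
        zero_mem' := ⟨0, map_zero _⟩
        algebraMap_mem' := fun r => ⟨reesChartBase a ha r, reesChart_reesChartBase a ha r⟩ }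
    change blowupAlgebra I a ≤ T
    refine Algebra.adjoin_le ?_
    rintro _ ⟨x, hx, rfl⟩
    refine ⟨HomogeneousLocalization.Away.mk (reesGrading I) (reesT_mem a ha) 1 (reesT x hx)
      (by simpa using reesT_mem x hx), ?_⟩
    rw [reesChart_mk a ha _ (r := x) (by rw [coe_reesT]), pow_one]

/-- **`(R[It])_{(at)} ≅ R[I/a]`**: the chart ring of the blowing up `Proj R[It]` at `a ∈ I` is
the affine blowup algebra (Stacks 0804: "`D₊(a^{(1)}) = Spec R[I/a]`").
[cite: StacksProject, Tag 0804] -/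
def reesChartEquiv : HomogeneousLocalization.Away (reesGrading I) (reesT a ha) ≃+* blowupAlgebra I a :=
  RingEquiv.ofBijective
    ((reesChart a ha).codRestrict (blowupAlgebra I a).toSubring fun y => by
      have hy : reesChart a ha y ∈ Set.range (reesChart a ha) := ⟨y, rfl⟩
      rw [range_reesChart a ha] at hy
      exact hy)
    ⟨fun y₁ y₂ h => reesChart_injective a ha (congrArg Subtype.val h), fun z => by
      have hz : (z : Localization.Away a) ∈ Set.range (reesChart a ha) := by
        rw [range_reesChart a ha]; exact z.2
      obtain ⟨y, hy⟩ := hz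
      exact ⟨y, Subtype.ext hy⟩⟩

/-- The isomorphism is the chart map. [folklore] -/
@[simp] theorem coe_reesChartEquiv (y : HomogeneousLocalization.Away (reesGrading I) (reesT a ha)) :
    (reesChartEquiv a ha y : Localization.Away a) = reesChart a ha y :=
  rfl

/-- Compatibility with the structure maps: `reesChartEquiv (r/1) = r`. [folklore] -/
theorem reesChartEquiv_reesChartBase (r : R) :
    reesChartEquiv a ha (reesChartBase a ha r) = algebraMap R (blowupAlgebra I a) r :=
  Subtype.ext (reesChart_reesChartBase a ha r)

/-- As ring maps: `reesChartEquiv ∘ reesChartBase = algebraMap R R[I/a]`. [folklore] -/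
theorem reesChartEquiv_comp_reesChartBase :
    (reesChartEquiv a ha).toRingHom.comp (reesChartBase a ha) = algebraMap R (blowupAlgebra I a) :=
  RingHom.ext (reesChartEquiv_reesChartBase a ha)

end ChartRing

end Literature.AlgebraicGeometry.Resolution

end
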